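import Summits.BirchSwinnertonDyer.Rank1Residual.GaloisImage.TwoLagrangianLinesPlaces
import Summits.BirchSwinnertonDyer.Rank1Residual.GaloisImage.CongruenceVisibilityIdentityComponentRat
import HarnessLib

/-!
# The seven free kinds in the `relIndex` currency, and the K-socket: THEOREM B (identity component at
# `3`) with every place off `3` served by the seven-kind certificate
# (cell `b2b-bsdres`, team n1011, row T-2LL FILE 11 = route planner 1's ST-50c "the D44-K socket" /
# lead R5-94 "K-socket word"; seat p04 GEN 11; TOOL theorems)

HONEST FRAMING (cell `b2b-bsdres`, run/shared/lean/b2b/bsd-rank1-residual/, verbatim in every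
file): the goal of the cell is to DELETE the COMBINATION-SHAPED residual classes of the
Birch–Swinnerton-Dyer formula for ALL analytic-rank `≤ 1` elliptic curves over `ℚ` — "full BSD
formula for every rank `≤ 1` curve in class `C`" assembled STRICTLY from published theorems — so
that the rank-`≤ 1` remainder becomes exactly the CONSTRUCTION-SHAPED classes, which are TYPED
(missing-input `Prop`s), NOT attempted. This is not "finishing BSD". Team n1011 (N10 / N11, the
additive block X4 ∧ `p = 3`): research route on the CONSTRUCTION-SHAPED class X4; no claim beyond
the stated classes; nothing is booked; no mark / label / count is changed by this file. Theorems
only (no definition, no new named fact, no `sorry`).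

## What

The D44-K rows of route planner 1 (`route1/g37_d44_serv.tsv`, 28 rows: `t₃ = 3`, tag `MG(A=2)` /
`GG(1,1)`) are NOT served by a local-conditions-agree kind at the place `3`: their road at `3` is
n1011-p10's THEOREM B (`TwistedWitness.exists_sha_ne_zero_of_congr_of_identityComponent[_rat]`, a
witness-refinement END with its own identity-component datum and two independent points), whose
OFF-`3` hypothesis `hoff` is stated in the `relIndex` currency
`(𝓢_v(E)).relIndex (θ_* 𝓢_v(E′)) = 1`.  This file is the plumbing between the two currencies:

* `TwoLagrangianLines.relIndex_map_selmerLocalKer_eq_one_of_kind₇` — at ONE place `w`, any of the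
  seven free kinds (i), (ii), (iii), (iv′), (vi), (iii′), (vii) of FILE 3's certificate gives
  `relIndex = 1` (generic number field `K`, odd prime `p`; the dispatch of FILE 3's proof, exported);
* `TwoLagrangianLines.exists_sha_ne_zero_of_congr_of_identityComponent_rat_of_places₇` — the
  K-SOCKET: n1011-p10's `exists_sha_ne_zero_of_congr_of_identityComponent_rat` (ℚ, `v₀` = the place
  of `3`) with `hoff` REPLACED by the seven-kind disjunction at every `v ∈ S`, `v ≠ v₀`; every other
  binder of THEOREM B verbatim (the identity-component data are n1011-p09's σ-decider output).

Conditional on A40 `hU` / A41 `hU2` through the multiplicative kinds only; closes nothing by itself.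

References: [CremonaMazur2000] §3; [MilneADT2006] I.3.3, I.3.8; [SilvermanATAEC1994] Ch. V;
cells/n1011/ROUTE-1.md §44.2, §49.3, §50 (ST-50c).
-/

set_option autoImplicit false

noncomputable section

open scoped Classical NumberField
open IsDedekindDomain NumberField WeierstrassCurve Field
  Literature.NumberTheory.EllipticCurves Literature.NumberTheory.EllipticCurves.Rank1Residual
  Literature.NumberTheory.EllipticCurves.Rank1Residual.Typed
  Literature.NumberTheory.GaloisRepresentations

namespace Summit.BirchSwinnertonDyer.Rank1Residual.GaloisImage

namespace TwoLagrangianLines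

section RelIndex

variable {K : Type} [Field K] [NumberField K] (W W' : WeierstrassCurve K) [W.IsElliptic]
  [W'.IsElliptic] {p : ℕ} [hp : Fact p.Prime]

/-- **The seven free kinds in the `relIndex` currency.** At a finite place `w` of a number field
`K`, for an odd prime `p` and a `Γ_K`-isomorphism `θ : E′[p] ≃ E[p]`: each of the seven kinds of
FILE 3's certificate (`exists_sha_ne_zero_of_congr_of_places₇`) gives
`(𝓢_w(E)).relIndex (θ_* 𝓢_w(E′)) = 1`, i.e. `θ_* 𝓢_w(E′) ≤ 𝓢_w(E)` — the dispatch of FILE 3's proof,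
exported for ENDs whose off-place hypothesis is stated as a relative index (n1011-p10's THEOREM B,
n1011-p17's hybrid witness ENDs). [cite: CremonaMazur2000, §3] [cite: MilneADT2006, Ch. I Prop. 3.8]
[cite: SilvermanATAEC1994, Ch. V Thm. 3.1, Lemma 5.2, Thm. 5.3, Cor. 5.4] -/
theorem relIndex_map_selmerLocalKer_eq_one_of_kind₇
    (hU : Silverman1994_thmV53_tateUniformisation.{0})
    (hU2 : Silverman1994_thmV53_corV54_tateUniformisation.{0})
    (hp2 : p ≠ 2)
    (θ : geomTorsion W' (p : ℤ) ≃+ geomTorsion W (p : ℤ))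
    (hθ : ∀ (σ : absoluteGaloisGroup K) (P : geomTorsion W' (p : ℤ)), θ (σ • P) = σ • θ P)
    {w : HeightOneSpectrum (𝓞 K)}
    (hkind :
      ((p : 𝓞 K) ∉ w.asIdeal ∧ Nat.card (nsmulAddMonoidHom p :
          (W'.baseChange (w.adicCompletion K)).toAffine.Point →+ _).ker = 1) ∨
      (W.HasSplitMultiplicativeReductionAt w ∧ W'.HasSplitMultiplicativeReductionAt w ∧
        Nat.card (nsmulAddMonoidHom p :
          (W.baseChange (w.adicCompletion K)).toAffine.Point →+ _).ker ≤ p) ∨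
      (W.HasMultiplicativeReductionAt w ∧ W'.HasMultiplicativeReductionAt w ∧
        (∃ r : w.adicCompletion K, algebraMap K (w.adicCompletion K) (-(W.c₄ / W.c₆)) =
          r ^ 2 * algebraMap K (w.adicCompletion K) (-(W'.c₄ / W'.c₆))) ∧
        (∀ ζ : w.adicCompletion K, ζ ^ p = 1 → ζ = 1)) ∨
      (W.HasMultiplicativeReductionAt w ∧
        ¬ IsSquare (algebraMap K (w.adicCompletion K) (-(W.c₄ / W.c₆))) ∧
        W'.HasGoodReductionAt w ∧ (p : 𝓞 K) ∉ w.asIdeal) ∨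
      (W.HasGoodReductionAt w ∧ W'.HasMultiplicativeReductionAt w ∧
        ¬ IsSquare (algebraMap K (w.adicCompletion K) (-(W'.c₄ / W'.c₆))) ∧
        (p : 𝓞 K) ∉ w.asIdeal) ∨
      (1 < w.valuation K W.j ∧ 1 < w.valuation K W'.j ∧
        (∃ r : w.adicCompletion K, algebraMap K (w.adicCompletion K) (-(W.c₄ / W.c₆)) =
          r ^ 2 * algebraMap K (w.adicCompletion K) (-(W'.c₄ / W'.c₆))) ∧
        (∀ ζ : w.adicCompletion K, ζ ^ p = 1 → ζ = 1)) ∨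
      (W.HasAdditiveReductionAt w ∧ W'.HasAdditiveReductionAt w ∧ (p : 𝓞 K) ∉ w.asIdeal ∧
        Nat.card (nsmulAddMonoidHom p :
          (W'.baseChange (w.adicCompletion K)).toAffine.Point →+ _).ker = p)) :
    (selmerLocalKer W (w.adicCompletion K) (p : ℤ)).relIndex
      ((selmerLocalKer W' (w.adicCompletion K) (p : ℤ)).map (h1Equiv θ hθ).toAddMonoidHom) = 1 := by
  rcases hkind with ⟨hwp, hloc⟩ | ⟨hWw, hW'w, hcardw⟩ | ⟨hWw, hW'w, hγw, hμw⟩ |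
      ⟨hWw, hγw, hW'w, hwp⟩ | ⟨hWw, hW'w, hγw, hwp⟩ | ⟨hWw, hW'w, hγw, hμw⟩ |
      ⟨hWw, hW'w, hwp, hcardw⟩
  · exact relIndex_map_selmerLocalKer_eq_one_of_card_torsion_eq_one W W' θ hθ hwp hloc
  all_goals refine (relIndex_map_selmerLocalKer_eq_one_iff W W' θ hθ).mpr fun c hc ↦ ?_
  · exact W.h1Equiv_mem_selmerLocalKer_of_hasSplitMultiplicativeReductionAt w hU W' θ hθ hWw
      hW'w hcardw hc
  · exact W.h1Equiv_mem_selmerLocalKer_of_hasMultiplicativeReductionAt w hU2 hp2 W' θ hθ hWw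
      hW'w hγw hμw hc
  · exact NonsplitKummer.h1Equiv_mem_selmerLocalKer_of_nonsplit_of_hasGoodReductionAt W w hU2 hp2
      W' θ hθ hWw hγw hW'w hwp hc
  · exact NonsplitKummer.h1Equiv_mem_selmerLocalKer_of_hasGoodReductionAt_of_nonsplit W W' w hU2
      hp2 θ hθ hWw hW'w hγw hwp hc
  · exact TwistedKummer.h1Equiv_mem_selmerLocalKer_of_one_lt_valuation_j W w hU2 hp2 W' θ hθ hWw
      hW'w hγw hμw hc
  · exact h1Equiv_mem_selmerLocalKer_of_hasAdditiveReductionAt₂ W W' w hWw hW'w hwp hp2 θ hθ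
      hcardw hc

end RelIndex

section KSocket

/-- **The K-SOCKET (route planner 1's ST-50c): THEOREM B over `ℚ` at `3` with every place off `3`
served by the seven-kind certificate.** n1011-p10's
`TwistedWitness.exists_sha_ne_zero_of_congr_of_identityComponent_rat` with its off-`3` hypothesis
`hoff` (relative indices) REPLACED by `hplaces`: at every `w ∈ S`, `w ≠ v₀`, one of the kinds (i),
(ii), (iii), (iv′), (vi), (iii′), (vii) (FILE 3 / FILE 5's `hplaces`, the literal-`3` instance); all
other binders — `E(ℚ)` finite of order prime to `3`, the two independent points `P₁ P₂` of `E′(ℚ)`,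
`#E(ℚ₃)[3] = #E′(ℚ₃)[3] = 3`, and the two identity-component data at `3` — VERBATIM.  Conditional on
`hU` / `hU2` through the multiplicative kinds; closes nothing until a D44-K record discharges it.
[cite: CremonaMazur2000, §3 pp. 19–22] [cite: MilneADT2006, Ch. I Prop. 3.8 and Lemma 3.3] -/
theorem exists_sha_ne_zero_of_congr_of_identityComponent_rat_of_places₇
    (hU : Silverman1994_thmV53_tateUniformisation.{0})
    (hU2 : Silverman1994_thmV53_corV54_tateUniformisation.{0})
    (W W' : WeierstrassCurve ℚ) [W.IsElliptic] [W'.IsElliptic]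
    (θ : geomTorsion W' ((3 : ℕ) : ℤ) ≃+ geomTorsion W ((3 : ℕ) : ℤ))
    (hθ : ∀ (σ : absoluteGaloisGroup ℚ) (P : geomTorsion W' ((3 : ℕ) : ℤ)), θ (σ • P) = σ • θ P)
    (S : Finset (HeightOneSpectrum (𝓞 ℚ)))
    (hS : ∀ v : HeightOneSpectrum (𝓞 ℚ), v ∉ S →
      W.HasGoodReductionAt v ∧ W'.HasGoodReductionAt v ∧ ((3 : ℕ) : 𝓞 ℚ) ∉ v.asIdeal)
    (hfin : Finite W.toAffine.Point) (hcop : (Nat.card W.toAffine.Point).Coprime 3)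
    (P₁ P₂ : W'.toAffine.Point)
    (hind : ∀ c₁ c₂ : ℤ, c₁ • P₁ + c₂ • P₂ ∈
      (zsmulAddGroupHom ((3 : ℕ) : ℤ) : W'.toAffine.Point →+ W'.toAffine.Point).range →
      (3 : ℤ) ∣ c₁ ∧ (3 : ℤ) ∣ c₂)
    (v₀ : HeightOneSpectrum (𝓞 ℚ)) (hv₀ : (Rat.HeightOneSpectrum.primesEquiv v₀ : ℕ) = 3)
    (hplaces : ∀ w ∈ S, w ≠ v₀ →
      (((3 : ℕ) : 𝓞 ℚ) ∉ w.asIdeal ∧ Nat.card (nsmulAddMonoidHom 3 :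
          (W'.baseChange (w.adicCompletion ℚ)).toAffine.Point →+ _).ker = 1) ∨
      (W.HasSplitMultiplicativeReductionAt w ∧ W'.HasSplitMultiplicativeReductionAt w ∧
        Nat.card (nsmulAddMonoidHom 3 :
          (W.baseChange (w.adicCompletion ℚ)).toAffine.Point →+ _).ker ≤ 3) ∨
      (W.HasMultiplicativeReductionAt w ∧ W'.HasMultiplicativeReductionAt w ∧
        (∃ r : w.adicCompletion ℚ, algebraMap ℚ (w.adicCompletion ℚ) (-(W.c₄ / W.c₆)) =
          r ^ 2 * algebraMap ℚ (w.adicCompletion ℚ) (-(W'.c₄ / W'.c₆))) ∧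
        (∀ ζ : w.adicCompletion ℚ, ζ ^ 3 = 1 → ζ = 1)) ∨
      (W.HasMultiplicativeReductionAt w ∧
        ¬ IsSquare (algebraMap ℚ (w.adicCompletion ℚ) (-(W.c₄ / W.c₆))) ∧
        W'.HasGoodReductionAt w ∧ ((3 : ℕ) : 𝓞 ℚ) ∉ w.asIdeal) ∨
      (W.HasGoodReductionAt w ∧ W'.HasMultiplicativeReductionAt w ∧
        ¬ IsSquare (algebraMap ℚ (w.adicCompletion ℚ) (-(W'.c₄ / W'.c₆))) ∧
        ((3 : ℕ) : 𝓞 ℚ) ∉ w.asIdeal) ∨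
      (1 < w.valuation ℚ W.j ∧ 1 < w.valuation ℚ W'.j ∧
        (∃ r : w.adicCompletion ℚ, algebraMap ℚ (w.adicCompletion ℚ) (-(W.c₄ / W.c₆)) =
          r ^ 2 * algebraMap ℚ (w.adicCompletion ℚ) (-(W'.c₄ / W'.c₆))) ∧
        (∀ ζ : w.adicCompletion ℚ, ζ ^ 3 = 1 → ζ = 1)) ∨
      (W.HasAdditiveReductionAt w ∧ W'.HasAdditiveReductionAt w ∧ ((3 : ℕ) : 𝓞 ℚ) ∉ w.asIdeal ∧
        Nat.card (nsmulAddMonoidHom 3 :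
          (W'.baseChange (w.adicCompletion ℚ)).toAffine.Point →+ _).ker = 3))
    (hcard : Nat.card (nsmulAddMonoidHom 3 :
      (W.baseChange (v₀.adicCompletion ℚ)).toAffine.Point →+ _).ker = 3)
    (hcard' : Nat.card (nsmulAddMonoidHom 3 :
      (W'.baseChange (v₀.adicCompletion ℚ)).toAffine.Point →+ _).ker = 3)
    (M : WeierstrassCurve (v₀.adicCompletionIntegers ℚ)) (C : VariableChange (v₀.adicCompletion ℚ))
    (hC : C • W.baseChange (v₀.adicCompletion ℚ) =
      M.map (algebraMap (v₀.adicCompletionIntegers ℚ) (v₀.adicCompletion ℚ)))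
    (x₀ y₀ a : IsLocalRing.ResidueField (v₀.adicCompletionIntegers ℚ))
    (hcusp : M.map (IsLocalRing.residue (v₀.adicCompletionIntegers ℚ)) = singularModel x₀ y₀ a a)
    {a₀ b₀ : v₀.adicCompletionIntegers ℚ}
    (hns₀ : (M.map (IsLocalRing.residue (v₀.adicCompletionIntegers ℚ))).toAffine.Nonsingular
      (IsLocalRing.residue (v₀.adicCompletionIntegers ℚ) a₀)
      (IsLocalRing.residue (v₀.adicCompletionIntegers ℚ) b₀))
    (hm : ((M.map (algebraMap (v₀.adicCompletionIntegers ℚ) (v₀.adicCompletion ℚ))).baseChange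
        (AlgebraicClosure (v₀.adicCompletion ℚ))).toAffine.Nonsingular
      (algebraMap (v₀.adicCompletionIntegers ℚ) (AlgebraicClosure (v₀.adicCompletion ℚ)) a₀)
      (algebraMap (v₀.adicCompletionIntegers ℚ) (AlgebraicClosure (v₀.adicCompletion ℚ)) b₀))
    (h3 : (3 : ℤ) • (Affine.Point.some _ _ hm :
      ((M.map (algebraMap (v₀.adicCompletionIntegers ℚ) (v₀.adicCompletion ℚ))).baseChange
        (AlgebraicClosure (v₀.adicCompletion ℚ))).toAffine.Point) = 0)
    (M' : WeierstrassCurve (v₀.adicCompletionIntegers ℚ)) (C' : VariableChange (v₀.adicCompletion ℚ))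
    (hC' : C' • W'.baseChange (v₀.adicCompletion ℚ) =
      M'.map (algebraMap (v₀.adicCompletionIntegers ℚ) (v₀.adicCompletion ℚ)))
    (x₀' y₀' a' : IsLocalRing.ResidueField (v₀.adicCompletionIntegers ℚ))
    (hcusp' : M'.map (IsLocalRing.residue (v₀.adicCompletionIntegers ℚ)) =
      singularModel x₀' y₀' a' a')
    {a₀' b₀' : v₀.adicCompletionIntegers ℚ}
    (hns₀' : (M'.map (IsLocalRing.residue (v₀.adicCompletionIntegers ℚ))).toAffine.Nonsingular
      (IsLocalRing.residue (v₀.adicCompletionIntegers ℚ) a₀')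
      (IsLocalRing.residue (v₀.adicCompletionIntegers ℚ) b₀'))
    (hm' : ((M'.map (algebraMap (v₀.adicCompletionIntegers ℚ) (v₀.adicCompletion ℚ))).baseChange
        (AlgebraicClosure (v₀.adicCompletion ℚ))).toAffine.Nonsingular
      (algebraMap (v₀.adicCompletionIntegers ℚ) (AlgebraicClosure (v₀.adicCompletion ℚ)) a₀')
      (algebraMap (v₀.adicCompletionIntegers ℚ) (AlgebraicClosure (v₀.adicCompletion ℚ)) b₀'))
    (h3' : (3 : ℤ) • (Affine.Point.some _ _ hm' :
      ((M'.map (algebraMap (v₀.adicCompletionIntegers ℚ) (v₀.adicCompletion ℚ))).baseChange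
        (AlgebraicClosure (v₀.adicCompletion ℚ))).toAffine.Point) = 0) :
    ∃ c : W.sha, c ≠ 0 ∧ 3 • c = 0 :=
  haveI : Fact (Nat.Prime 3) := ⟨Nat.prime_three⟩
  TwistedWitness.exists_sha_ne_zero_of_congr_of_identityComponent_rat W W' θ hθ S hS hfin hcop P₁ P₂
    hind v₀ hv₀
    (fun v hv hne ↦ relIndex_map_selmerLocalKer_eq_one_of_kind₇ W W' hU hU2 (by norm_num) θ hθ
      (hplaces v hv hne))
    hcard hcard' M C hC x₀ y₀ a hcusp hns₀ hm h3 M' C' hC' x₀' y₀' a' hcusp' hns₀' hm' h3'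

end KSocket

end TwoLagrangianLines

end Summit.BirchSwinnertonDyer.Rank1Residual.GaloisImage

end
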